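import Mathlib
import Summits.ValiantsHypothesis.ValiantsHypothesis.Theorems.FifoMatchingNNMonotoneHardReduction
import Summits.ValiantsHypothesis.ValiantsHypothesis.Theorems.ZeroOneTransfer.Negative.TopComponentFree
import Summits.ValiantsHypothesis.ValiantsHypothesis.Theorems.ZeroOneTransfer.Negative.KillRows
import Literature.Computability.AlgebraicComplexity.NestFreeMatchingPoly
import Literature.Computability.AlgebraicComplexity.ValiantClassesProofs
import HarnessLib

/-!
# Route FifoMatching — crux `NNLinearDegreeCofactorHard` (stmt-ValiantsHypothesis-23918), line `internal_cofactor`: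
# COFACTOR REMOVAL for stub S2b `stub_denseInternalHard`, and the reduction of S2b to a spread
# measure on `R`-avoiding nest-free matchings

Registered line `Cruxes/NNLinearDegreeCofactorHard/Lines/internal_cofactor.lean` (S1, S2a landed).  S2b
(`stub_denseInternalHard`) asks, for an INTERNAL cofactor `p ≠ 0` on `R ⊆ [2n]` (every variable of `p`
is an arc `x_(i,j)`, `i, j ∈ R`), for a quasi-polynomial monotone lower bound on `NN_n · p`.  Here:

* `topComponent_inner_mul` — for the weight `w_R(e) = 0` if both endpoints of `e` lie in `R`, `1`
  otherwise, `p` is `w_R`-homogeneous of weight `0`, so `top_{w_R}(NN_n · p) = top_{w_R}(NN_n) · p`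
  (`topComponent_mul`), and top components are free over `ℝ≥0` (`complexity_topComponent_le`);
* `topComponent_inner_nestFreeMatchingPoly` — if SOME nest-free perfect matching of `[2n]` has no arc
  inside `R`, then `top_{w_R}(NN_n) = P_R := Σ_{M ∈ 𝓕_R} x^M`, the arc polynomial of the family
  `𝓕_R = {M nest-free perfect : ∀ i ∈ R, M i ∉ R}` of `R`-AVOIDING nest-free perfect matchings;
* `complexity_avoiding_le` — **cofactor removal**: `L₊(P_R) ≤ L₊(NN_n · p) + 1` (free the arcs
  inside `R`: `p ↦ p(1) > 0`, a scalar, while `P_R` has no such arc; rescale);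
* `exists_balanced_split_of_complexity_family` — the landed union bound
  (`exists_balanced_split_of_complexity`) for an ARBITRARY family of perfect matchings of `[2n]`;
* `denseInternalHard_of_avoidingSpread` — hence the body of S2b (for a given `a`) follows from
  `AvoidingSpread(a)`: eventually in `n`, for every admissible `R`, a probability weighting of `𝓕_R`
  under which every ORDINARY balanced split `T ⊆ [2n]` (`2n < 3|T| ≤ 4n`) is respected with mass
  `< 1 / (4 (2^((log₂ n + c)^c) + 1) (n+1)²)` — no defect events, no degree hypothesis on `p`: S2b
  needs exactly a spread measure SUPPORTED ON `𝓕_R` (every `R`-vertex paired into `[2n] ∖ R`).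

Honest framing: a reduction for one registered stub of one line of an OPEN crux; S2b, the crux,
`NNDivisionHard`, `NNNotVP` stay open; monotone ≠ general (`…Barriers.ValiantsHypothesis.MonotoneGap`);
nothing here is progress on `VP ≠ VNP` (NOT proved).  No definitions, no named facts. [folklore]
-/

noncomputable section

-- Sub = Summit single-conjunct layout: the duplicated namespace component is mandated by the tree.
set_option linter.dupNamespace false

namespace Summit.ValiantsHypothesis.ValiantsHypothesis.Theorems.FifoMatching.NNLinearDegreeCofactorHard.InternalCofactor

open MvPolynomial Finset Literature.Computability.AlgebraicComplexity
open Summit.ValiantsHypothesis.ValiantsHypothesis.Theorems.ZeroOneTransfer.Negative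
open Summit.ValiantsHypothesis.ValiantsHypothesis.Theorems.FifoMatching.NNMonotoneHard
open scoped NNReal

variable {n : ℕ}

/-! ### The weight `w_R` (`0` on arcs inside `R`, `1` elsewhere) on arc sets of matchings -/
/-- The `w_R`-weight of the arc set of `M` is the number of arcs of `M` NOT inside `R`. [folklore] -/
theorem weight_inner_arcExponent (R : Finset (Fin (2 * n))) (M : Fin (2 * n) → Fin (2 * n)) :
    Finsupp.weight (fun e : Fin (2 * n) × Fin (2 * n) => if e.1 ∈ R ∧ e.2 ∈ R then (0 : ℕ) else 1)
        (arcExponent M) =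
      ((openers M).filter fun i => ¬ (i ∈ R ∧ M i ∈ R)).card := by
  rw [arcExponent, map_sum, card_filter]
  refine sum_congr rfl fun i _ => ?_
  rw [Finsupp.weight_single, smul_eq_mul, one_mul]
  by_cases h : i ∈ R ∧ M i ∈ R
  · rw [if_pos h, if_neg (not_not_intro h)]
  · rw [if_neg h, if_pos h]

/-- The `w_R`-weight of the arc set of a perfect matching of `[2n]` is at most `n`. [folklore] -/
theorem weight_inner_arcExponent_le (R : Finset (Fin (2 * n))) {M : Fin (2 * n) → Fin (2 * n)}
    (hM : M ∈ perfectMatchings (2 * n)) :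
    Finsupp.weight (fun e : Fin (2 * n) × Fin (2 * n) => if e.1 ∈ R ∧ e.2 ∈ R then (0 : ℕ) else 1)
        (arcExponent M) ≤ n := by
  rw [weight_inner_arcExponent]
  exact (card_filter_le _ _).trans (card_openers hM).le

/-- The `w_R`-weight of the arc set of a perfect matching `M` of `[2n]` equals `n` iff `M` has no
arc inside `R` (`∀ i ∈ R, M i ∉ R`). [folklore] -/
theorem weight_inner_arcExponent_eq_iff (R : Finset (Fin (2 * n))) {M : Fin (2 * n) → Fin (2 * n)}
    (hM : M ∈ perfectMatchings (2 * n)) :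
    Finsupp.weight (fun e : Fin (2 * n) × Fin (2 * n) => if e.1 ∈ R ∧ e.2 ∈ R then (0 : ℕ) else 1)
        (arcExponent M) = n ↔ ∀ i ∈ R, M i ∉ R := by
  obtain ⟨hinv, hfp⟩ := mem_perfectMatchings.1 hM
  have hn := card_openers hM
  rw [weight_inner_arcExponent]
  constructor
  · intro h i hi hMi
    have hall : (openers M).filter (fun i => ¬ (i ∈ R ∧ M i ∈ R)) = openers M :=
      eq_of_subset_of_card_le (filter_subset _ _) (hn.trans h.symm).le
    rcases lt_or_gt_of_ne (hfp i).symm with hlt | hgt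
    · have := (mem_filter.1 (hall.symm ▸ mem_openers.2 hlt : i ∈ (openers M).filter _)).2
      exact this ⟨hi, hMi⟩
    · have hop : M i ∈ openers M := mem_openers.2 (by rw [hinv]; exact hgt)
      have := (mem_filter.1 (hall.symm ▸ hop : M i ∈ (openers M).filter _)).2
      exact this ⟨hMi, by rw [hinv]; exact hi⟩
  · intro h
    refine Eq.trans ?_ hn
    congr 1
    exact filter_true_of_mem fun i _ hiR => h i hiR.1 hiR.2

/-! ### The top `w_R`-component of `NN_n` -/
/-- If some nest-free perfect matching of `[2n]` avoids the arcs inside `R`, the `w_R`-weighted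
total degree of `NN_n` is `n`. [folklore] -/
theorem weightedTotalDegree_inner_nestFreeMatchingPoly (R : Finset (Fin (2 * n)))
    (hex : ∃ M ∈ nestFreeMatchings (2 * n), ∀ i ∈ R, M i ∉ R) :
    weightedTotalDegree (fun e : Fin (2 * n) × Fin (2 * n) => if e.1 ∈ R ∧ e.2 ∈ R then (0 : ℕ) else 1)
      (nestFreeMatchingPoly n ℝ≥0) = n := by
  rw [weightedTotalDegree, support_nestFreeMatchingPoly]
  apply le_antisymm
  · refine Finset.sup_le fun d hd => ?_
    obtain ⟨M, hM, rfl⟩ := mem_image.1 hd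
    exact weight_inner_arcExponent_le R (nestFreeMatchings_subset_perfectMatchings hM)
  · obtain ⟨M, hM, hav⟩ := hex
    have hw := (weight_inner_arcExponent_eq_iff R (nestFreeMatchings_subset_perfectMatchings hM)).2 hav
    exact le_trans hw.ge (Finset.le_sup (f := fun s => Finsupp.weight _ s)
      (mem_image_of_mem arcExponent hM))

/-- **The top `w_R`-component of `NN_n` is the arc polynomial `P_R` of the `R`-avoiding nest-free
perfect matchings** (provided one exists). [folklore] -/
theorem topComponent_inner_nestFreeMatchingPoly (R : Finset (Fin (2 * n)))
    (hex : ∃ M ∈ nestFreeMatchings (2 * n), ∀ i ∈ R, M i ∉ R) :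
    topComponent (fun e : Fin (2 * n) × Fin (2 * n) => if e.1 ∈ R ∧ e.2 ∈ R then (0 : ℕ) else 1)
        (nestFreeMatchingPoly n ℝ≥0) =
      ∑ M ∈ (nestFreeMatchings (2 * n)).filter (fun M => ∀ i ∈ R, M i ∉ R), arcMonomial ℝ≥0 M := by
  have hsub : (nestFreeMatchings (2 * n)).filter (fun M => ∀ i ∈ R, M i ∉ R) ⊆
      perfectMatchings (2 * n) :=
    (filter_subset _ _).trans nestFreeMatchings_subset_perfectMatchings
  refine MvPolynomial.ext _ _ fun d => ?_
  rw [coeff_topComponent, weightedTotalDegree_inner_nestFreeMatchingPoly R hex,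
    coeff_nestFreeMatchingPoly, coeff_sum_arcMonomial hsub]
  by_cases h1 : ∃ M ∈ (nestFreeMatchings (2 * n)).filter (fun M => ∀ i ∈ R, M i ∉ R),
      arcExponent M = d
  · obtain ⟨M, hM, rfl⟩ := h1
    obtain ⟨hMnf, hav⟩ := mem_filter.1 hM
    rw [if_pos ((weight_inner_arcExponent_eq_iff R
      (nestFreeMatchings_subset_perfectMatchings hMnf)).2 hav), if_pos ⟨M, hMnf, rfl⟩,
      if_pos ⟨M, hM, rfl⟩]
  · rw [if_neg h1]
    split_ifs with hw h2
    · obtain ⟨M, hM, rfl⟩ := h2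
      exact absurd ⟨M, mem_filter.2 ⟨hM, (weight_inner_arcExponent_eq_iff R
        (nestFreeMatchings_subset_perfectMatchings hM)).1 hw⟩, rfl⟩ h1
    · rfl
    · rfl

/-! ### Internal cofactors are `w_R`-homogeneous of weight `0` -/
/-- A polynomial all of whose variables are arcs inside `R` is `w_R`-homogeneous of weight `0`.
[folklore] -/
theorem isWeightedHomogeneous_inner_of_internal (R : Finset (Fin (2 * n)))
    {p : MvPolynomial (Fin (2 * n) × Fin (2 * n)) ℝ≥0}
    (hint : ∀ d ∈ p.support, ∀ e ∈ d.support, e.1 ∈ R ∧ e.2 ∈ R) :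
    IsWeightedHomogeneous
      (fun e : Fin (2 * n) × Fin (2 * n) => if e.1 ∈ R ∧ e.2 ∈ R then (0 : ℕ) else 1) p 0 := by
  intro d hd
  rw [Finsupp.weight_apply, Finsupp.sum]
  refine sum_eq_zero fun e he => ?_
  rw [if_pos (hint d (mem_support_iff.2 hd) e he), smul_zero]

/-- `top_{w_R}(NN_n · p) = top_{w_R}(NN_n) · p` for an internal cofactor `p` on `R`. [folklore] -/
theorem topComponent_inner_mul (R : Finset (Fin (2 * n)))
    {p : MvPolynomial (Fin (2 * n) × Fin (2 * n)) ℝ≥0}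
    (hint : ∀ d ∈ p.support, ∀ e ∈ d.support, e.1 ∈ R ∧ e.2 ∈ R) :
    topComponent (fun e : Fin (2 * n) × Fin (2 * n) => if e.1 ∈ R ∧ e.2 ∈ R then (0 : ℕ) else 1)
        (nestFreeMatchingPoly n ℝ≥0 * p) =
      topComponent (fun e : Fin (2 * n) × Fin (2 * n) => if e.1 ∈ R ∧ e.2 ∈ R then (0 : ℕ) else 1)
        (nestFreeMatchingPoly n ℝ≥0) * p := by
  rw [topComponent_mul, topComponent_eq_self_of_isWeightedHomogeneous _
    (isWeightedHomogeneous_inner_of_internal R hint)]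

/-! ### Freeing the arcs inside `R` -/
/-- Freeing the arcs inside `R` (`x_e ↦ 1` for `e ∈ R × R`, other variables kept) is a projection.
[folklore] -/
theorem isProjection_aeval_freeInner (R : Finset (Fin (2 * n)))
    (q : MvPolynomial (Fin (2 * n) × Fin (2 * n)) ℝ≥0) :
    IsProjection (aeval (fun e : Fin (2 * n) × Fin (2 * n) =>
      if e.1 ∈ R ∧ e.2 ∈ R then (1 : MvPolynomial (Fin (2 * n) × Fin (2 * n)) ℝ≥0) else X e) q) q := by
  refine ⟨_, fun e => ?_, rfl⟩
  by_cases h : e.1 ∈ R ∧ e.2 ∈ R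
  · exact Or.inr ⟨1, by rw [if_pos h, C_1]⟩
  · exact Or.inl ⟨e, by rw [if_neg h]⟩

/-- Freeing the arcs inside `R` turns an internal cofactor on `R` into the constant `Σ_d coeff_d p`.
[folklore] -/
theorem aeval_freeInner_of_internal (R : Finset (Fin (2 * n)))
    {p : MvPolynomial (Fin (2 * n) × Fin (2 * n)) ℝ≥0}
    (hint : ∀ d ∈ p.support, ∀ e ∈ d.support, e.1 ∈ R ∧ e.2 ∈ R) :
    aeval (fun e : Fin (2 * n) × Fin (2 * n) =>
        if e.1 ∈ R ∧ e.2 ∈ R then (1 : MvPolynomial (Fin (2 * n) × Fin (2 * n)) ℝ≥0) else X e) p =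
      C (∑ d ∈ p.support, coeff d p) := by
  classical
  conv_lhs => rw [p.as_sum]
  rw [map_sum, map_sum]
  refine sum_congr rfl fun d hd => ?_
  rw [aeval_monomial, ← C_eq_algebraMap]
  suffices h : (d.prod fun e k => (if e.1 ∈ R ∧ e.2 ∈ R then
      (1 : MvPolynomial (Fin (2 * n) × Fin (2 * n)) ℝ≥0) else X e) ^ k) = 1 by
    rw [h, mul_one]
  refine Finset.prod_eq_one fun e he => ?_
  show (if e.1 ∈ R ∧ e.2 ∈ R then (1 : MvPolynomial (Fin (2 * n) × Fin (2 * n)) ℝ≥0) else X e)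
    ^ (d e) = 1
  rw [if_pos (hint d hd e he), one_pow]

/-- Freeing the arcs inside `R` fixes the arc monomial of an `R`-avoiding matching. [folklore] -/
theorem aeval_freeInner_arcMonomial_of_avoiding (R : Finset (Fin (2 * n)))
    {M : Fin (2 * n) → Fin (2 * n)} (hav : ∀ i ∈ R, M i ∉ R) :
    aeval (fun e : Fin (2 * n) × Fin (2 * n) =>
        if e.1 ∈ R ∧ e.2 ∈ R then (1 : MvPolynomial (Fin (2 * n) × Fin (2 * n)) ℝ≥0) else X e)
      (arcMonomial ℝ≥0 M) = arcMonomial ℝ≥0 M := by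
  rw [arcMonomial_eq_prod_openers, map_prod]
  refine prod_congr rfl fun i _ => ?_
  rw [aeval_X, if_neg fun h => hav i h.1 h.2]

/-- Freeing the arcs inside `R` fixes `P_R`. [folklore] -/
theorem aeval_freeInner_avoiding (R : Finset (Fin (2 * n))) :
    aeval (fun e : Fin (2 * n) × Fin (2 * n) =>
        if e.1 ∈ R ∧ e.2 ∈ R then (1 : MvPolynomial (Fin (2 * n) × Fin (2 * n)) ℝ≥0) else X e)
      (∑ M ∈ (nestFreeMatchings (2 * n)).filter (fun M => ∀ i ∈ R, M i ∉ R), arcMonomial ℝ≥0 M) =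
      ∑ M ∈ (nestFreeMatchings (2 * n)).filter (fun M => ∀ i ∈ R, M i ∉ R), arcMonomial ℝ≥0 M := by
  rw [map_sum]
  exact sum_congr rfl fun M hM => aeval_freeInner_arcMonomial_of_avoiding R (mem_filter.1 hM).2

/-! ### Cofactor removal -/
/-- **Cofactor removal.** If some nest-free perfect matching of `[2n]` avoids the arcs inside `R`,
then for every nonzero INTERNAL cofactor `p` on `R`: `L₊(P_R) ≤ L₊(NN_n · p) + 1`, `P_R` the arc
polynomial of the `R`-avoiding nest-free perfect matchings — top `w_R`-component (free; `= P_R · p`),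
free the arcs inside `R` (a projection; `p ↦ p(1) ≠ 0`, `P_R` fixed), rescale (one gate). [folklore] -/
theorem complexity_avoiding_le (R : Finset (Fin (2 * n)))
    (hex : ∃ M ∈ nestFreeMatchings (2 * n), ∀ i ∈ R, M i ∉ R)
    {p : MvPolynomial (Fin (2 * n) × Fin (2 * n)) ℝ≥0} (hp : p ≠ 0)
    (hint : ∀ d ∈ p.support, ∀ e ∈ d.support, e.1 ∈ R ∧ e.2 ∈ R) :
    complexity (∑ M ∈ (nestFreeMatchings (2 * n)).filter (fun M => ∀ i ∈ R, M i ∉ R),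
        arcMonomial ℝ≥0 M) ≤ complexity (nestFreeMatchingPoly n ℝ≥0 * p) + 1 := by
  set w : Fin (2 * n) × Fin (2 * n) → ℕ := fun e => if e.1 ∈ R ∧ e.2 ∈ R then 0 else 1 with hw
  set φ : Fin (2 * n) × Fin (2 * n) → MvPolynomial (Fin (2 * n) × Fin (2 * n)) ℝ≥0 := fun e =>
    if e.1 ∈ R ∧ e.2 ∈ R then 1 else X e with hφ
  set P := ∑ M ∈ (nestFreeMatchings (2 * n)).filter (fun M => ∀ i ∈ R, M i ∉ R),
    arcMonomial ℝ≥0 M with hP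
  set c : ℝ≥0 := ∑ d ∈ p.support, coeff d p with hc
  have hc0 : c ≠ 0 := sum_coeff_ne_zero hp
  -- the image of the top component under the freeing projection is `c • P`
  have himage : aeval φ (topComponent w (nestFreeMatchingPoly n ℝ≥0 * p)) = c • P := by
    rw [topComponent_inner_mul R hint, map_mul, topComponent_inner_nestFreeMatchingPoly R hex,
      aeval_freeInner_avoiding R, aeval_freeInner_of_internal R hint]
    exact (mul_comm _ _).trans C_mul'
  have h1 : complexity (c • P) ≤ complexity (nestFreeMatchingPoly n ℝ≥0 * p) := by
    rw [← himage]
    exact (complexity_le_of_isProjection (isProjection_aeval_freeInner R _)).trans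
      (complexity_topComponent_le w _)
  calc complexity P = complexity (c⁻¹ • (c • P)) := by rw [smul_smul, inv_mul_cancel₀ hc0, one_smul]
    _ ≤ complexity (c • P) + 1 := complexity_smul_le_holds _ _
    _ ≤ complexity (nestFreeMatchingPoly n ℝ≥0 * p) + 1 := Nat.add_le_add_right h1 1

/-! ### The union bound for an arbitrary family of perfect matchings -/
/-- **Union bound for a family.** For `n ≥ 3`, a family `𝓕` of perfect matchings of `[2n]` and a
nonnegative weighting `μ` of `𝓕` of total mass `1`, some balanced split `S ⊆ [2n]`
(`2n < 3|S| ≤ 4n`) is respected by the members of `𝓕` with mass at least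
`1 / (4 · L₊(P_𝓕) · (n+1)²)`, `P_𝓕 = Σ_{M ∈ 𝓕} x^M` (the landed `exists_balanced_split_of_complexity`
is the case `𝓕 =` all nest-free perfect matchings; same proof). [folklore] -/
theorem exists_balanced_split_of_complexity_family (hn : 3 ≤ n)
    {𝓕 : Finset (Fin (2 * n) → Fin (2 * n))} (h𝓕 : 𝓕 ⊆ perfectMatchings (2 * n))
    (μ : (Fin (2 * n) → Fin (2 * n)) → ℝ≥0) (hμ : ∑ M ∈ 𝓕, μ M = 1) :
    ∃ S : Finset (Fin (2 * n)), 2 * n < 3 * S.card ∧ 3 * S.card ≤ 4 * n ∧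
      (1 : ℝ≥0) ≤ (4 * complexity (∑ M ∈ 𝓕, arcMonomial ℝ≥0 M) * (n + 1) ^ 2 : ℕ) *
        ∑ M ∈ 𝓕.filter (fun M => ∀ i, i ∈ S ↔ M i ∈ S), μ M := by
  classical
  set q := ∑ M ∈ 𝓕, arcMonomial ℝ≥0 M with hq
  set s := complexity q with hs
  have hhom : q.IsHomogeneous n :=
    sum_arcMonomial_isHomogeneous fun M hM => card_openers (h𝓕 hM)
  obtain ⟨L, hLlen, hLsum, hL⟩ := exists_homogeneous_balanced_decomposition_of_complexity_le
    (le_refl s) hhom hn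
  -- the splits attached to the terms
  have hsplit : ∀ t ∈ L, ∃ S : Finset (Fin (2 * n)), 2 * n < 3 * S.card ∧ 3 * S.card ≤ 4 * n ∧
      ∀ x ∈ (t.2.1 * t.2.2).support, ∃ M ∈ 𝓕, arcExponent M = x ∧ ∀ i, i ∈ S ↔ M i ∈ S := by
    intro t ht
    obtain ⟨hhom', h1, h2, hne, hle⟩ := hL t ht
    obtain ⟨S, hScard, hS⟩ := exists_balanced_vertex_split h𝓕 hhom' hne hle
    exact ⟨S, by omega, by omega, hS⟩
  choose! Sp hSp using hsplit
  -- every member of `𝓕` lies in the class of some term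
  have hcover : ∀ M ∈ 𝓕, ∃ t ∈ L, ∀ i, i ∈ Sp t ↔ M i ∈ Sp t := by
    intro M hM
    have hx : arcExponent M ∈ q.support := by
      rw [hq, support_sum_arcMonomial h𝓕, mem_image]
      exact ⟨M, hM, rfl⟩
    have hx' : ∃ t ∈ L, arcExponent M ∈ (t.2.1 * t.2.2).support := by
      by_contra hcon
      push Not at hcon
      rw [mem_support_iff, ← hLsum] at hx
      apply hx
      rw [← coeffAddMonoidHom_apply, map_list_sum]
      apply List.sum_eq_zero
      intro c hc
      rw [List.map_map, List.mem_map] at hc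
      obtain ⟨t, ht, rfl⟩ := hc
      simpa [coeffAddMonoidHom_apply, notMem_support_iff] using hcon t ht
    obtain ⟨t, ht, hxt⟩ := hx'
    obtain ⟨M', hM', hM'x, hresp⟩ := (hSp t ht).2.2 _ hxt
    have hMM' : M' = M := arcExponent_injOn (h𝓕 hM') (h𝓕 hM) hM'x
    subst hMM'
    exact ⟨t, ht, hresp⟩
  -- the union bound
  set T := L.toFinset with hT
  set mass : (ℕ × MvPolynomial (Fin (2 * n) × Fin (2 * n)) ℝ≥0 ×
      MvPolynomial (Fin (2 * n) × Fin (2 * n)) ℝ≥0) → ℝ≥0 := fun t =>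
    ∑ M ∈ 𝓕.filter (fun M => ∀ i, i ∈ Sp t ↔ M i ∈ Sp t), μ M with hmass
  have hbound : (1 : ℝ≥0) ≤ ∑ t ∈ T, mass t := by
    rw [← hμ]
    have hrw : ∀ t ∈ T, mass t = ∑ M ∈ 𝓕,
        if (∀ i, i ∈ Sp t ↔ M i ∈ Sp t) then μ M else 0 := by
      intro t _
      simp only [hmass]
      rw [sum_filter]
    rw [sum_congr rfl hrw, sum_comm]
    refine sum_le_sum fun M hM => ?_
    obtain ⟨t, ht, hresp⟩ := hcover M hM
    have ht' : t ∈ T := by rw [hT, List.mem_toFinset]; exact ht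
    refine le_trans ?_ (single_le_sum (f := fun t => if (∀ i, i ∈ Sp t ↔ M i ∈ Sp t)
      then μ M else 0) (fun _ _ => zero_le) ht')
    simp only [if_pos hresp, le_refl]
  have hTne : T.Nonempty := by
    rw [nonempty_iff_ne_empty]
    rintro hTe
    rw [hTe, sum_empty] at hbound
    exact absurd hbound (by simp)
  obtain ⟨t₀, ht₀, hmax⟩ := exists_max_image T mass hTne
  have ht₀L : t₀ ∈ L := by rw [hT, List.mem_toFinset] at ht₀; exact ht₀
  refine ⟨Sp t₀, (hSp t₀ ht₀L).1, (hSp t₀ ht₀L).2.1, ?_⟩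
  calc (1 : ℝ≥0) ≤ ∑ t ∈ T, mass t := hbound
    _ ≤ ∑ _t ∈ T, mass t₀ := sum_le_sum hmax
    _ = (T.card : ℝ≥0) * mass t₀ := by rw [sum_const, nsmul_eq_mul]
    _ ≤ ((4 * s * (n + 1) ^ 2 : ℕ) : ℝ≥0) * mass t₀ := by
        gcongr
        exact_mod_cast (List.toFinset_card_le (l := L)).trans hLlen

/-! ### S2b from a spread measure on `R`-avoiding nest-free matchings -/
/-- **Stub S2b (`stub_denseInternalHard`) for a given `a`, from `AvoidingSpread(a)`:** if for every
`c`, eventually in `n`, every `R ⊆ [2n]` with `a·|R| ≤ 2n` and no run of length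
`G = 2((log₂ n + c)^c + log₂ n + 1)^6 + 12` in its complement carries a weighting `μ ≥ 0` of the
`R`-AVOIDING nest-free perfect matchings `𝓕_R`, of mass `1`, with `4 (2^((log₂ n + c)^c) + 1) (n+1)² · m_S < 1`
for the mass `m_S` of every balanced split `S ⊆ [2n]` (`2n < 3|S| ≤ 4n`), then the conclusion of S2b
holds with this `a` (the hypothesis `a·deg p ≤ n` is not used).  Proof: mass `1` forces `𝓕_R ≠ ∅`;
`complexity_avoiding_le` and `exists_balanced_split_of_complexity_family`. [folklore] -/
theorem denseInternalHard_of_avoidingSpread (a : ℕ)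
    (h : ∀ c : ℕ, ∃ n₀ : ℕ, ∀ n ≥ n₀, ∀ R : Finset (Fin (2 * n)), a * R.card ≤ 2 * n →
      (¬ ∃ s : ℕ, s + (2 * ((Nat.log 2 n + c) ^ c + Nat.log 2 n + 1) ^ 6 + 12) ≤ 2 * n ∧
        ∀ j : Fin (2 * n), s ≤ j.val →
          j.val < s + (2 * ((Nat.log 2 n + c) ^ c + Nat.log 2 n + 1) ^ 6 + 12) → j ∉ R) →
      ∃ μ : (Fin (2 * n) → Fin (2 * n)) → ℝ≥0,
        (∑ M ∈ (nestFreeMatchings (2 * n)).filter (fun M => ∀ i ∈ R, M i ∉ R), μ M = 1) ∧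
        ∀ S : Finset (Fin (2 * n)), 2 * n < 3 * S.card → 3 * S.card ≤ 4 * n →
          ((4 * (2 ^ ((Nat.log 2 n + c) ^ c) + 1) * (n + 1) ^ 2 : ℕ) : ℝ≥0) *
            (∑ M ∈ ((nestFreeMatchings (2 * n)).filter (fun M => ∀ i ∈ R, M i ∉ R)).filter
              (fun M => ∀ i, i ∈ S ↔ M i ∈ S), μ M) < 1) :
    ∀ c : ℕ, ∃ n₀ : ℕ, ∀ n ≥ n₀, ∀ R : Finset (Fin (2 * n)), a * R.card ≤ 2 * n →
      (¬ ∃ s : ℕ, s + (2 * ((Nat.log 2 n + c) ^ c + Nat.log 2 n + 1) ^ 6 + 12) ≤ 2 * n ∧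
        ∀ j : Fin (2 * n), s ≤ j.val →
          j.val < s + (2 * ((Nat.log 2 n + c) ^ c + Nat.log 2 n + 1) ^ 6 + 12) → j ∉ R) →
      ∀ p : MvPolynomial (Fin (2 * n) × Fin (2 * n)) ℝ≥0, p ≠ 0 → a * p.totalDegree ≤ n →
        (∀ d ∈ p.support, ∀ e ∈ d.support, e.1 ∈ R ∧ e.2 ∈ R) →
          2 ^ ((Nat.log 2 n + c) ^ c) < complexity (nestFreeMatchingPoly n ℝ≥0 * p) := by
  intro c
  obtain ⟨n₀, hn₀⟩ := h c
  refine ⟨max n₀ 3, fun n hn R hR hrun p hp _ hint => ?_⟩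
  have hn3 : 3 ≤ n := le_of_max_le_right hn
  obtain ⟨μ, hμ, hsmall⟩ := hn₀ n (le_of_max_le_left hn) R hR hrun
  set 𝓕 := (nestFreeMatchings (2 * n)).filter (fun M => ∀ i ∈ R, M i ∉ R) with h𝓕def
  have h𝓕 : 𝓕 ⊆ perfectMatchings (2 * n) :=
    (filter_subset _ _).trans nestFreeMatchings_subset_perfectMatchings
  have hex : ∃ M ∈ nestFreeMatchings (2 * n), ∀ i ∈ R, M i ∉ R := by
    by_contra hne
    push Not at hne
    have h0 : 𝓕 = ∅ := by
      rw [h𝓕def, filter_eq_empty_iff]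
      intro M hM hall
      obtain ⟨i, hi, hMi⟩ := hne M hM
      exact hall i hi hMi
    rw [h0, sum_empty] at hμ
    exact zero_ne_one hμ
  set K := 2 ^ ((Nat.log 2 n + c) ^ c) with hK
  by_contra hle
  push Not at hle
  have hP : complexity (∑ M ∈ 𝓕, arcMonomial ℝ≥0 M) ≤ K + 1 :=
    (complexity_avoiding_le R hex hp hint).trans (Nat.add_le_add_right hle 1)
  obtain ⟨S, h1, h2, hbig⟩ := exists_balanced_split_of_complexity_family hn3 h𝓕 μ hμ
  have hlt := hsmall S h1 h2
  have hmono : ((4 * complexity (∑ M ∈ 𝓕, arcMonomial ℝ≥0 M) * (n + 1) ^ 2 : ℕ) : ℝ≥0) ≤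
      ((4 * (K + 1) * (n + 1) ^ 2 : ℕ) : ℝ≥0) := by
    exact_mod_cast Nat.mul_le_mul_right _ (Nat.mul_le_mul_left _ hP)
  exact absurd (lt_of_le_of_lt (hbig.trans (mul_le_mul_of_nonneg_right hmono zero_le)) hlt)
    (lt_irrefl _)

end Summit.ValiantsHypothesis.ValiantsHypothesis.Theorems.FifoMatching.NNLinearDegreeCofactorHard.InternalCofactor

end
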